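import Mathlib
import Summits.Ventures.PercRepro2.TypedFactor
import Summits.Ventures.PercRepro2.TypedSplit
import Summits.Ventures.PercRepro2.TypedUntouched
import Summits.Ventures.PercRepro2.OStarGlueSum
import Summits.Ventures.PercRepro2.TwoMarkHubConn

/-!
# The placement sum of a two-mark hub (blind cell PercRepro2, mine-2 g40, 2026-08-28;
`proofs/MINE2-HUBK5.md` §2, row M2-85 — part II of the hub gluing lemma)

**`typedCount_hub_eq`**: for a hub (`TwoMarkHubConn.lean`), the typed count over the typed hub edges
of a function of the three neighbour sets is its `plc` sum over the placements of the seven slots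
with their types (`typ`: absent `0`, typed `τ e`, pinned open / closed `3` / `0`) — seven
applications of g39's one-slot `peel` (`OStarGlueSum.lean`), the slots being distinct edges
(`IsHub.ne_of_slots`), nothing of the hub side left after the seventh (`eraseO_hub_eq_empty`).
Own code; standard axioms.
-/

namespace Summit.Ventures.PercRepro2

open UnionCluster

namespace CovForm

namespace THub

open OneTyped Untouched OStar K5 TypedFactor TypedRed

section HubCount

variable {V : Type*} {E : Type*} [Fintype E] [DecidableEq E] {R : Type*} [Field R]
variable {ends : E → Sym2 V} {o a₁ a₂ a₃ b : V} {h : HubType} {slot : Fin 7 → Option E}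

omit [Fintype E] in
/-- Membership in an erased set. -/
lemma mem_eraseO {s : Option E} {A : Finset E} {e : E} (he : e ∈ eraseO s A) :
    e ∈ A ∧ s ≠ some e := by
  cases s with
  | none => exact ⟨he, by simp⟩
  | some e' =>
    simp only [eraseO, Finset.mem_erase] at he
    exact ⟨he.2, by simpa using he.1.symm⟩

omit [Fintype E] in
/-- After the seven slots are erased nothing of the hub side is left. -/
lemma eraseO_hub_eq_empty (hH : IsHub ends o a₁ a₂ a₃ b h slot) {A : Finset E}
    (hA : ∀ e ∈ A, mark o a₁ a₂ a₃ b h.c₁ ∈ ends e ∨ mark o a₁ a₂ a₃ b h.c₂ ∈ ends e) :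
    eraseO (slot 6) (eraseO (slot 5) (eraseO (slot 4) (eraseO (slot 3) (eraseO (slot 2)
      (eraseO (slot 1) (eraseO (slot 0) A)))))) = ∅ := by
  ext e
  simp only [Finset.notMem_empty, iff_false]
  intro he
  obtain ⟨h6, n6⟩ := mem_eraseO he
  obtain ⟨h5, n5⟩ := mem_eraseO h6
  obtain ⟨h4, n4⟩ := mem_eraseO h5
  obtain ⟨h3, n3⟩ := mem_eraseO h4
  obtain ⟨h2, n2⟩ := mem_eraseO h3
  obtain ⟨h1, n1⟩ := mem_eraseO h2
  obtain ⟨h0, n0⟩ := mem_eraseO h1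
  obtain ⟨i, hi⟩ := hH.all e (hA e h0)
  fin_cases i
  · exact n0 hi
  · exact n1 hi
  · exact n2 hi
  · exact n3 hi
  · exact n4 hi
  · exact n5 hi
  · exact n6 hi

/-- **The hub side count is the placement sum**: the typed count over the typed hub edges of a
function of the three neighbour sets is the `plc` sum of that function over the placements of the
seven slots with their types. -/
theorem typedCount_hub_eq (hH : IsHub ends o a₁ a₂ a₃ b h slot) {A : Finset E}
    (hA : ∀ e ∈ A, mark o a₁ a₂ a₃ b h.c₁ ∈ ends e ∨ mark o a₁ a₂ a₃ b h.c₂ ∈ ends e)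
    (z : Config E) (τ : E → ℕ) (g : Nb7 → Nb7 → Nb7 → R) :
    typedCount A z τ (fun x y w => g (nbr slot x) (nbr slot y) (nbr slot w)) =
      ((plc (typ (slot 0) A z τ)).map fun c0 =>
      ((plc (typ (slot 1) A z τ)).map fun c1 =>
      ((plc (typ (slot 2) A z τ)).map fun c2 =>
      ((plc (typ (slot 3) A z τ)).map fun c3 =>
      ((plc (typ (slot 4) A z τ)).map fun c4 =>
      ((plc (typ (slot 5) A z τ)).map fun c5 =>
      ((plc (typ (slot 6) A z τ)).map fun c6 =>
      g (c0.1, c1.1, c2.1, c3.1, c4.1, c5.1, c6.1) (c0.2.1, c1.2.1, c2.2.1, c3.2.1, c4.2.1, c5.2.1, c6.2.1)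
        (c0.2.2, c1.2.2, c2.2.2, c3.2.2, c4.2.2, c5.2.2, c6.2.2)).sum).sum).sum).sum).sum).sum).sum := by
  have hne : ∀ i j : Fin 7, i ≠ j → ∀ e e', slot i = some e → slot j = some e' → e ≠ e' :=
    fun i j hij e e' hi hj => hH.ne_of_slots hij hi hj
  simp only [nbr]
  -- slot 0
  rw [peel (slot 0)
      A
      z τ
      (fun v1 v2 v3 x y w => g
        (v1, val (slot 1) x, val (slot 2) x, val (slot 3) x,
          val (slot 4) x, val (slot 5) x, val (slot 6) x)
        (v2, val (slot 1) y, val (slot 2) y, val (slot 3) y,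
          val (slot 4) y, val (slot 5) y, val (slot 6) y)
        (v3, val (slot 1) w, val (slot 2) w, val (slot 3) w,
          val (slot 4) w, val (slot 5) w, val (slot 6) w))]
  refine congrArg List.sum (List.map_congr_left fun c0 _ => ?_)
  simp only [val_updO (hne 0 1 (by decide)), val_updO (hne 0 2 (by decide)), val_updO (hne 0 3 (by decide)),
    val_updO (hne 0 4 (by decide)), val_updO (hne 0 5 (by decide)), val_updO (hne 0 6 (by decide))]
  -- slot 1
  rw [peel (slot 1)
      (eraseO (slot 0) A)
      (updO (slot 0) z false) τ
      (fun v1 v2 v3 x y w => g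
        (c0.1, v1, val (slot 2) x, val (slot 3) x,
          val (slot 4) x, val (slot 5) x, val (slot 6) x)
        (c0.2.1, v2, val (slot 2) y, val (slot 3) y,
          val (slot 4) y, val (slot 5) y, val (slot 6) y)
        (c0.2.2, v3, val (slot 2) w, val (slot 3) w,
          val (slot 4) w, val (slot 5) w, val (slot 6) w)),
    typ_eraseO_updO (hne 0 1 (by decide))]
  refine congrArg List.sum (List.map_congr_left fun c1 _ => ?_)
  simp only [val_updO (hne 1 2 (by decide)), val_updO (hne 1 3 (by decide)), val_updO (hne 1 4 (by decide)),
    val_updO (hne 1 5 (by decide)), val_updO (hne 1 6 (by decide))]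
  -- slot 2
  rw [peel (slot 2)
      (eraseO (slot 1) (eraseO (slot 0) A))
      (updO (slot 1) (updO (slot 0) z false) false) τ
      (fun v1 v2 v3 x y w => g
        (c0.1, c1.1, v1, val (slot 3) x,
          val (slot 4) x, val (slot 5) x, val (slot 6) x)
        (c0.2.1, c1.2.1, v2, val (slot 3) y,
          val (slot 4) y, val (slot 5) y, val (slot 6) y)
        (c0.2.2, c1.2.2, v3, val (slot 3) w,
          val (slot 4) w, val (slot 5) w, val (slot 6) w)),
    typ_eraseO_updO (hne 1 2 (by decide)),
    typ_eraseO_updO (hne 0 2 (by decide))]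
  refine congrArg List.sum (List.map_congr_left fun c2 _ => ?_)
  simp only [val_updO (hne 2 3 (by decide)), val_updO (hne 2 4 (by decide)), val_updO (hne 2 5 (by decide)),
    val_updO (hne 2 6 (by decide))]
  -- slot 3
  rw [peel (slot 3)
      (eraseO (slot 2) (eraseO (slot 1) (eraseO (slot 0) A)))
      (updO (slot 2) (updO (slot 1) (updO (slot 0) z false) false) false) τ
      (fun v1 v2 v3 x y w => g
        (c0.1, c1.1, c2.1, v1,
          val (slot 4) x, val (slot 5) x, val (slot 6) x)
        (c0.2.1, c1.2.1, c2.2.1, v2,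
          val (slot 4) y, val (slot 5) y, val (slot 6) y)
        (c0.2.2, c1.2.2, c2.2.2, v3,
          val (slot 4) w, val (slot 5) w, val (slot 6) w)),
    typ_eraseO_updO (hne 2 3 (by decide)),
    typ_eraseO_updO (hne 1 3 (by decide)),
    typ_eraseO_updO (hne 0 3 (by decide))]
  refine congrArg List.sum (List.map_congr_left fun c3 _ => ?_)
  simp only [val_updO (hne 3 4 (by decide)), val_updO (hne 3 5 (by decide)), val_updO (hne 3 6 (by decide))]
  -- slot 4
  rw [peel (slot 4)
      (eraseO (slot 3) (eraseO (slot 2) (eraseO (slot 1) (eraseO (slot 0) A))))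
      (updO (slot 3) (updO (slot 2) (updO (slot 1) (updO (slot 0) z false) false) false) false) τ
      (fun v1 v2 v3 x y w => g
        (c0.1, c1.1, c2.1, c3.1,
          v1, val (slot 5) x, val (slot 6) x)
        (c0.2.1, c1.2.1, c2.2.1, c3.2.1,
          v2, val (slot 5) y, val (slot 6) y)
        (c0.2.2, c1.2.2, c2.2.2, c3.2.2,
          v3, val (slot 5) w, val (slot 6) w)),
    typ_eraseO_updO (hne 3 4 (by decide)),
    typ_eraseO_updO (hne 2 4 (by decide)),
    typ_eraseO_updO (hne 1 4 (by decide)),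
    typ_eraseO_updO (hne 0 4 (by decide))]
  refine congrArg List.sum (List.map_congr_left fun c4 _ => ?_)
  simp only [val_updO (hne 4 5 (by decide)), val_updO (hne 4 6 (by decide))]
  -- slot 5
  rw [peel (slot 5)
      (eraseO (slot 4) (eraseO (slot 3) (eraseO (slot 2) (eraseO (slot 1) (eraseO (slot 0) A)))))
      (updO (slot 4) (updO (slot 3) (updO (slot 2) (updO (slot 1) (updO (slot 0) z false) false) false) false) false) τ
      (fun v1 v2 v3 x y w => g
        (c0.1, c1.1, c2.1, c3.1,
          c4.1, v1, val (slot 6) x)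
        (c0.2.1, c1.2.1, c2.2.1, c3.2.1,
          c4.2.1, v2, val (slot 6) y)
        (c0.2.2, c1.2.2, c2.2.2, c3.2.2,
          c4.2.2, v3, val (slot 6) w)),
    typ_eraseO_updO (hne 4 5 (by decide)),
    typ_eraseO_updO (hne 3 5 (by decide)),
    typ_eraseO_updO (hne 2 5 (by decide)),
    typ_eraseO_updO (hne 1 5 (by decide)),
    typ_eraseO_updO (hne 0 5 (by decide))]
  refine congrArg List.sum (List.map_congr_left fun c5 _ => ?_)
  simp only [val_updO (hne 5 6 (by decide))]
  -- slot 6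
  rw [peel (slot 6)
      (eraseO (slot 5) (eraseO (slot 4) (eraseO (slot 3) (eraseO (slot 2) (eraseO (slot 1) (eraseO (slot 0) A))))))
      (updO (slot 5) (updO (slot 4) (updO (slot 3) (updO (slot 2) (updO (slot 1) (updO (slot 0) z false) false) false) false) false) false) τ
      (fun v1 v2 v3 x y w => g
        (c0.1, c1.1, c2.1, c3.1,
          c4.1, c5.1, v1)
        (c0.2.1, c1.2.1, c2.2.1, c3.2.1,
          c4.2.1, c5.2.1, v2)
        (c0.2.2, c1.2.2, c2.2.2, c3.2.2,
          c4.2.2, c5.2.2, v3)),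
    typ_eraseO_updO (hne 5 6 (by decide)),
    typ_eraseO_updO (hne 4 6 (by decide)),
    typ_eraseO_updO (hne 3 6 (by decide)),
    typ_eraseO_updO (hne 2 6 (by decide)),
    typ_eraseO_updO (hne 1 6 (by decide)),
    typ_eraseO_updO (hne 0 6 (by decide))]
  refine congrArg List.sum (List.map_congr_left fun c6 _ => ?_)
  rw [eraseO_hub_eq_empty hH hA]
  exact typedCount_empty _ _ _

end HubCount

end THub

end CovForm

end Summit.Ventures.PercRepro2
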